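import Literature.MathematicalPhysics.QuantumFieldTheory.Balaban1983to89.LatticeFieldCalculus
import Literature.MathematicalPhysics.QuantumFieldTheory.Balaban1983to89.T4Covariance
import HarnessLib

/-!
# Route `UnitScaleTilt`, crux K1 «MinimiserStabilityRegPr» (stmt-QuantumFields-19200), leaf V2′ `stub_halvingStep` — branch (P2-small) «H-SMALL», mechanism (α)
# COVERING ∕ PERIODISATION (★★OWNER RULING g26-№18): **brick α3b-GENERIC — THE BLOCK AVERAGES `Q′` (sites) AND `Q` (bonds), ONE STEP AND ITERATED, INTERTWINE WITH
# THE PULLBACK AND WITH THE PUSHFORWARD OF A LEVEL-INDEXED FAMILY OF LATTICE HOMOMORPHISMS RESPECTING BLOCKS** (e.g. the covering maps `proj i` of brick α1)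

Cell `ym3-torus` (HUMAN RULING D-0037, YM ladder rung R3 — continuum SU(2) YM₃ on the torus is a RUNG, not the Clay problem), width seat `ym-ust-19200-w5` gen 3
(LEAD (S3), H-SMALL planner).  `--supports stmt-QuantumFields-19200 --as helper`; def-free, 0 sorry, standard axioms.

SETTING (as ✓`…CoverStencils`, now across levels).  `hd : P′.d = P.d`, `hL : P′.L = P.L`, a family `φ i : Site P′ i → Site P i` with `φ i (x + e_μ) = φ i x + e_μ`
(`hs`) and `φ i (blockSite ỹ r) = blockSite (φ (i+1) ỹ) r` (`hblk`, offsets read through the casts); for the pushforward also `φ (i+1) (blockOf x) = blockOf (φ i x)`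
(`hbo`).  NO injectivity.  Block-offset sums are reindexed by `castOff := Equiv.arrowCongr (finCongr hd) (finCongr hL)`.
* §1 one combinatorial lemma ★`sum_offsets_fibre_blockSite` — `Σ_r Σ_{x′ : φ x′ = blockSite y (castOff r)} F x′ = Σ_{y′ : φ y′ = y} Σ_{r′} F (blockSite y′ r′)`
  (both sides are `Σ_{x′ : φ (blockOf x′) = y} F x′; ✓`Site.blockEquiv`);
* §2 pullbacks: `segSum_comp`, `siteAvg_comp`, `bondAvg_comp`, `siteAvgIter_comp`, `bondAvgIter_comp` (`Q_k(A ∘ φB₀) = (Q_k A) ∘ φB_k`);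
* §3 pushforwards: `siteAvg_push`, `siteAvgIter_push`, `run_fibre_bijective`, `bondAvg_push`, `bondAvgIter_push` (`Q_k(φB₀_* g)(c) = Σ_{c′ : φB_k c′ = c} (Q_k g)(c′)`).
With `QE_apply`∕`QpE_apply` (rfl on `bondAvgIter`∕`siteAvgIter`) these are the `hQ`∕`QpE` inputs of ✓`CoverFlatOps.hOp_intertwine` ∕ `starProjection_intertwine_of_push`
(α3c), instantiated by α1's `proj` (`hs := proj_shift`, `hblk := proj_blockSite`, `hbo := proj_blockOf`).  NOT a claim about the mass gap.

References: T. Bałaban, CMP **95** (1984) 17–40 [Balaban1984PropagatorsI] ((1.11)–(1.13) p.19, (1.16)–(1.20) p.20); CMP **96** (1984) 223–250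
[Balaban1984PropagatorsII] ((2.14) p.225, (2.20) p.226).
-/

noncomputable section

open scoped BigOperators Classical

namespace Summit.QuantumFields.YangMills.Theorems.CoverAverages

open Literature.MathematicalPhysics.QuantumFieldTheory.Balaban1983to89
open LatticeFieldCalculus (segSum runSite runBond siteAvg bondAvg siteAvgIter bondAvgIter runSite_succ runSite_zero)

variable {P P' : Params} (hd : P'.d = P.d) (hL : P'.L = P.L) (φ : (i : ℕ) → Site P' i → Site P i)
  (hs : ∀ (i : ℕ) (x : Site P' i) (μ : Fin P'.d), φ i (x.shift μ) = (φ i x).shift (Fin.cast hd μ))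
  (hblk : ∀ (i : ℕ) (y : Site P' (i + 1)) (r : Fin P'.d → Fin P'.L),
    φ i (Site.blockSite y r) = Site.blockSite (φ (i + 1) y) ((Equiv.arrowCongr (finCongr hd) (finCongr hL)) r))
  (hbo : ∀ (i : ℕ) (x : Site P' i), φ (i + 1) (blockOf x) = blockOf (φ i x))

/-! ## §1 The combinatorial lemma: regrouping the block-offset sums over the fibres -/

/-- inverse cast of offsets, evaluated. [folklore] -/
theorem arrowCongr_apply (r : Fin P'.d → Fin P'.L) (μ : Fin P.d) :
    (Equiv.arrowCongr (finCongr hd) (finCongr hL)) r μ = Fin.cast hL (r (Fin.cast hd.symm μ)) := by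
  simp [Equiv.arrowCongr_apply, finCongr_symm]

include hbo in
/-- the inner regrouping downstairs-indexed: `Σ_r Σ_{x′ : φ x′ = blockSite y r} F x′ = Σ_{x′ : φ(blockOf x′) = y} F x′`. [folklore] -/
theorem sum_offsets_fibre_eq (i : ℕ) (hi : i + 1 ≤ P.m + P.K) (y : Site P (i + 1)) {M : Type*} [AddCommMonoid M] (F : Site P' i → M) :
    ∑ r : Fin P.d → Fin P.L, ∑ x' : {x' : Site P' i // φ i x' = Site.blockSite y r}, F x'.1 =
      ∑ x' : {x' : Site P' i // φ (i + 1) (blockOf x') = y}, F x'.1 := by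
  -- regroup the right-hand side along `x' ↦ offsets (φ x')` (an element of `Fin d → Fin L`)
  let κ : {x' : Site P' i // φ (i + 1) (blockOf x') = y} → (Fin P.d → Fin P.L) :=
    fun x' => Site.blockEquiv hi y ⟨φ i x'.1, by rw [← hbo]; exact x'.2⟩
  rw [← Fintype.sum_fiberwise κ (fun x' => F x'.1)]
  refine Finset.sum_congr rfl fun r _ => ?_
  -- the fibre of `κ` over `r` is `{x' // φ x' = blockSite y r}`
  have key : ∀ x' : Site P' i, φ i x' = Site.blockSite y r ↔ ∃ h : φ (i + 1) (blockOf x') = y, κ ⟨x', h⟩ = r := by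
    intro x'
    constructor
    · intro hx
      have hb : φ (i + 1) (blockOf x') = y := by rw [hbo, hx, Site.blockOf_blockSite hi]
      refine ⟨hb, ?_⟩
      show Site.blockEquiv hi y ⟨φ i x', _⟩ = r
      have : (⟨φ i x', by rw [← hbo]; exact hb⟩ : {x : Site P i // blockOf x = y}) = (Site.blockEquiv hi y).symm r :=
        Subtype.ext (by exact hx)
      rw [this, Equiv.apply_symm_apply]
    · rintro ⟨hb, hr⟩
      have h1 : ((Site.blockEquiv hi y).symm (κ ⟨x', hb⟩)).1 = φ i x' := by
        show ((Site.blockEquiv hi y).symm (Site.blockEquiv hi y ⟨φ i x', _⟩)).1 = φ i x'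
        rw [Equiv.symm_apply_apply]
      rw [hr] at h1
      exact h1.symm
  refine Fintype.sum_bijective (fun x' : {x' : Site P' i // φ i x' = Site.blockSite y r} =>
      (⟨⟨x'.1, ((key x'.1).mp x'.2).choose⟩, ((key x'.1).mp x'.2).choose_spec⟩ : {x' : {x' : Site P' i // φ (i + 1) (blockOf x') = y} // κ x' = r}))
    ?_ (fun x' => F x'.1) (fun x' => F x'.1.1) (fun _ => rfl)
  refine Function.bijective_iff_has_inverse.mpr ⟨fun z => ⟨z.1.1, (key z.1.1).mpr ⟨z.1.2, z.2⟩⟩, fun x' => rfl, fun z => rfl⟩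

/-- the inner regrouping upstairs-indexed: `Σ_{y′ : φ y′ = y} Σ_{r′} F (blockSite y′ r′) = Σ_{x′ : φ(blockOf x′) = y} F x′`. [folklore] -/
theorem sum_fibre_offsets_eq (i : ℕ) (hi' : i + 1 ≤ P'.m + P'.K) (y : Site P (i + 1)) {M : Type*} [AddCommMonoid M] (F : Site P' i → M) :
    ∑ y' : {y' : Site P' (i + 1) // φ (i + 1) y' = y}, ∑ r' : Fin P'.d → Fin P'.L, F (Site.blockSite y'.1 r') =
      ∑ x' : {x' : Site P' i // φ (i + 1) (blockOf x') = y}, F x'.1 := by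
  let β : {x' : Site P' i // φ (i + 1) (blockOf x') = y} → {y' : Site P' (i + 1) // φ (i + 1) y' = y} :=
    fun x' => ⟨blockOf x'.1, x'.2⟩
  rw [← Fintype.sum_fiberwise β (fun x' => F x'.1)]
  refine Finset.sum_congr rfl fun y' _ => ?_
  -- the fibre of `β` over `y'` is the block of `y'`, parametrised by the offsets
  refine Fintype.sum_bijective (fun r' : Fin P'.d → Fin P'.L =>
      (⟨⟨Site.blockSite y'.1 r', by show φ (i + 1) (blockOf (Site.blockSite y'.1 r')) = y; rw [Site.blockOf_blockSite hi', y'.2]⟩,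
        Subtype.ext (Site.blockOf_blockSite hi' y'.1 r')⟩ : {x' : {x' : Site P' i // φ (i + 1) (blockOf x') = y} // β x' = y'}))
    ?_ (fun r' => F (Site.blockSite y'.1 r')) (fun x' => F x'.1.1) (fun _ => rfl)
  refine Function.bijective_iff_has_inverse.mpr
    ⟨fun z => Site.blockEquiv hi' y'.1 ⟨z.1.1, congrArg Subtype.val z.2⟩, fun r' => ?_, fun z => ?_⟩
  · exact (Site.blockEquiv hi' y'.1).apply_symm_apply r'
  · have h : ((Site.blockEquiv hi' y'.1).symm (Site.blockEquiv hi' y'.1 ⟨z.1.1, congrArg Subtype.val z.2⟩)).1 = z.1.1 := by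
      rw [Equiv.symm_apply_apply]
    exact Subtype.ext (Subtype.ext h)

include hbo in
/-- ★ **`Σ_r Σ_{x′ : φ x′ = blockSite y r} F x′ = Σ_{y′ : φ y′ = y} Σ_{r′} F (blockSite y′ r′)`** — both sides are the sum of `F` over `{x′ : φ(blockOf x′) = y}`.
[cite: Balaban1984PropagatorsI, (1.13) p.19] -/
theorem sum_offsets_fibre_blockSite {M : Type*} [AddCommMonoid M] (i : ℕ) (hi : i + 1 ≤ P.m + P.K) (hi' : i + 1 ≤ P'.m + P'.K)
    (y : Site P (i + 1)) (F : Site P' i → M) :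
    ∑ r : Fin P.d → Fin P.L, ∑ x' : {x' : Site P' i // φ i x' = Site.blockSite y r}, F x'.1 =
      ∑ y' : {y' : Site P' (i + 1) // φ (i + 1) y' = y}, ∑ r' : Fin P'.d → Fin P'.L, F (Site.blockSite y'.1 r') := by
  rw [sum_offsets_fibre_eq φ hbo i hi y F, sum_fibre_offsets_eq φ i hi' y F]

/-! ## §2 Pullbacks -/

include hs in
/-- straight runs: `φ (x + t e_μ) = φ x + t e_μ`. [cite: Balaban1984PropagatorsI, (1.7) p.18] -/
theorem map_runSite (i : ℕ) (x : Site P' i) (μ : Fin P'.d) (t : ℕ) : φ i (runSite x μ t) = runSite (φ i x) (Fin.cast hd μ) t := by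
  induction t with
  | zero => simp [runSite_zero]
  | succ t ih => rw [runSite_succ, hs, ih, ← runSite_succ]

include hs in
/-- `Σ_{t<n} A(φB(run bond)) = segSum A (φ x) μ n`. [cite: Balaban1984PropagatorsI, (1.7) p.18] -/
theorem segSum_comp (i : ℕ) (A : VecField P i ℝ) (x : Site P' i) (μ : Fin P'.d) (n : ℕ) :
    segSum (fun b' : PBond P' i => A ⟨φ i b'.src, Fin.cast hd b'.dir⟩) x μ n = segSum A (φ i x) (Fin.cast hd μ) n := by
  simp only [segSum, runBond, map_runSite hd φ hs]

include hblk in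
/-- **`Q′(λ ∘ φ_i) = (Q′λ) ∘ φ_{i+1}`**. [cite: Balaban1984PropagatorsI, (1.13) p.19] -/
theorem siteAvg_comp (i : ℕ) (lam : SiteField P i ℝ) (y : Site P' (i + 1)) :
    siteAvg (lam ∘ φ i) y = siteAvg lam (φ (i + 1) y) := by
  simp only [siteAvg, Function.comp_apply, hblk]
  have e : ((P'.L : ℝ) ^ P'.d)⁻¹ = ((P.L : ℝ) ^ P.d)⁻¹ := by rw [hd, hL]
  rw [e, ← Equiv.sum_comp (Equiv.arrowCongr (finCongr hd) (finCongr hL))]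

include hs hblk in
/-- **`Q(A ∘ φB_i) = (QA) ∘ φB_{i+1}`**. [cite: Balaban1984PropagatorsI, (1.11) p.19] -/
theorem bondAvg_comp (i : ℕ) (A : VecField P i ℝ) (c : PBond P' (i + 1)) :
    bondAvg (fun b' : PBond P' i => A ⟨φ i b'.src, Fin.cast hd b'.dir⟩) c = bondAvg A ⟨φ (i + 1) c.src, Fin.cast hd c.dir⟩ := by
  simp only [bondAvg, segSum_comp hd φ hs, hblk]
  have e : ((P'.L : ℝ) ^ (P'.d + 1))⁻¹ = ((P.L : ℝ) ^ (P.d + 1))⁻¹ := by rw [hd, hL]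
  have eL : ∀ (x : Site P i) (μ : Fin P.d), segSum A x μ P'.L = segSum A x μ P.L := fun x μ => by rw [hL]
  rw [e, ← Equiv.sum_comp (Equiv.arrowCongr (finCongr hd) (finCongr hL))]
  simp only [eL]

include hblk in
/-- **`Q′_k(λ ∘ φ_0) = (Q′_kλ) ∘ φ_k`**. [cite: Balaban1984PropagatorsI, (1.20) p.20] -/
theorem siteAvgIter_comp (lam : SiteField P 0 ℝ) : ∀ k : ℕ, siteAvgIter k (lam ∘ φ 0) = siteAvgIter k lam ∘ φ k
  | 0 => rfl
  | k + 1 => by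
    funext y
    change siteAvg (siteAvgIter k (lam ∘ φ 0)) y = siteAvg (siteAvgIter k lam) (φ (k + 1) y)
    rw [siteAvgIter_comp lam k, siteAvg_comp hd hL φ hblk]

include hs hblk in
/-- **`Q_k(A ∘ φB_0) = (Q_kA) ∘ φB_k`**. [cite: Balaban1984PropagatorsI, (1.18) p.20] -/
theorem bondAvgIter_comp (A : VecField P 0 ℝ) :
    ∀ (k : ℕ) (c : PBond P' k), bondAvgIter k (fun b' : PBond P' 0 => A ⟨φ 0 b'.src, Fin.cast hd b'.dir⟩) c = bondAvgIter k A ⟨φ k c.src, Fin.cast hd c.dir⟩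
  | 0, c => rfl
  | k + 1, c => by
    change bondAvg (bondAvgIter k (fun b' : PBond P' 0 => A ⟨φ 0 b'.src, Fin.cast hd b'.dir⟩)) c = bondAvg (bondAvgIter k A) ⟨φ (k + 1) c.src, Fin.cast hd c.dir⟩
    have ih : bondAvgIter k (fun b' : PBond P' 0 => A ⟨φ 0 b'.src, Fin.cast hd b'.dir⟩) =
        fun b' : PBond P' k => bondAvgIter k A ⟨φ k b'.src, Fin.cast hd b'.dir⟩ := funext (bondAvgIter_comp A k)
    rw [ih, bondAvg_comp hd hL φ hs hblk]

/-! ## §3 Pushforwards -/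

include hd hL hbo in
/-- **`Q′(φ_{i*} g)(y) = Σ_{y′ : φ y′ = y} (Q′ g)(y′)`**. [cite: Balaban1984PropagatorsI, (1.13) p.19] -/
theorem siteAvg_push (i : ℕ) (hi : i + 1 ≤ P.m + P.K) (hi' : i + 1 ≤ P'.m + P'.K) (g : Site P' i → ℝ) (y : Site P (i + 1)) :
    siteAvg (fun x : Site P i => ∑ x' : {x' : Site P' i // φ i x' = x}, g x'.1) y =
      ∑ y' : {y' : Site P' (i + 1) // φ (i + 1) y' = y}, siteAvg g y'.1 := by
  simp only [siteAvg]
  have e : ((P'.L : ℝ) ^ P'.d)⁻¹ = ((P.L : ℝ) ^ P.d)⁻¹ := by rw [hd, hL]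
  simp only [smul_eq_mul, e, ← Finset.mul_sum]
  congr 1
  exact sum_offsets_fibre_blockSite φ hbo i hi hi' y g

include hd hL hbo in
/-- **`Q′_k(φ_{0*} g)(y) = Σ_{y′ : φ_k y′ = y} (Q′_k g)(y′)`**. [cite: Balaban1984PropagatorsI, (1.20) p.20] -/
theorem siteAvgIter_push (g : Site P' 0 → ℝ) :
    ∀ (k : ℕ), k ≤ P.m + P.K → k ≤ P'.m + P'.K → ∀ y : Site P k,
      siteAvgIter k (fun x : Site P 0 => ∑ x' : {x' : Site P' 0 // φ 0 x' = x}, g x'.1) y =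
        ∑ y' : {y' : Site P' k // φ k y' = y}, siteAvgIter k g y'.1
  | 0, _, _, y => rfl
  | k + 1, hk, hk', y => by
    change siteAvg (siteAvgIter k (fun x : Site P 0 => ∑ x' : {x' : Site P' 0 // φ 0 x' = x}, g x'.1)) y = _
    have ih : siteAvgIter k (fun x : Site P 0 => ∑ x' : {x' : Site P' 0 // φ 0 x' = x}, g x'.1) =
        fun z : Site P k => ∑ z' : {z' : Site P' k // φ k z' = z}, siteAvgIter k g z'.1 :=
      funext (siteAvgIter_push g k (Nat.le_of_succ_le hk) (Nat.le_of_succ_le hk'))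
    rw [ih, siteAvg_push hd hL φ hbo k hk hk']
    rfl

include hs in
/-- fibres are `+ t e_μ`-equivariant: `x′ ↦ x′ + t e_μ` is a bijection from the fibre of `x` onto the fibre of `x + t e_μ`. [folklore] -/
theorem run_fibre_bijective (i : ℕ) (x : Site P i) (μ' : Fin P'.d) (t : ℕ) :
    Function.Bijective (fun x' : {x' : Site P' i // φ i x' = x} =>
      (⟨runSite x'.1 μ' t, by rw [map_runSite hd φ hs, x'.2]⟩ : {x' : Site P' i // φ i x' = runSite x (Fin.cast hd μ') t})) := by
  induction t with
  | zero =>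
    refine Function.bijective_iff_has_inverse.mpr ⟨fun z => ⟨z.1, by simpa [runSite_zero] using z.2⟩, fun x' => ?_, fun z => ?_⟩
    · exact Subtype.ext (runSite_zero x'.1 μ')
    · exact Subtype.ext (runSite_zero z.1 μ')
  | succ t ih =>
    -- `run (t+1) = shift ∘ run t`
    have hstep : Function.Bijective (fun z : {x' : Site P' i // φ i x' = runSite x (Fin.cast hd μ') t} =>
        (⟨z.1.shift μ', by rw [hs, z.2, ← runSite_succ]⟩ : {x' : Site P' i // φ i x' = runSite x (Fin.cast hd μ') (t + 1)})) :=
      Function.bijective_iff_has_inverse.mpr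
        ⟨fun w => ⟨w.1.unshift μ', by
            have hw : φ i w.1 = (runSite x (Fin.cast hd μ') t).shift (Fin.cast hd μ') := by rw [← runSite_succ]; exact w.2
            have : φ i (w.1.unshift μ') = (φ i w.1).unshift (Fin.cast hd μ') := by
              have h1 := hs i (w.1.unshift μ') μ'
              rw [Site.shift_unshift] at h1
              rw [h1, Site.unshift_shift]
            rw [this, hw, Site.unshift_shift]⟩,
          fun z => Subtype.ext (Site.unshift_shift z.1 μ'), fun w => Subtype.ext (Site.shift_unshift w.1 μ')⟩
    have hcomp : (fun x' : {x' : Site P' i // φ i x' = x} =>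
        (⟨runSite x'.1 μ' (t + 1), by rw [map_runSite hd φ hs, x'.2]⟩ : {x' : Site P' i // φ i x' = runSite x (Fin.cast hd μ') (t + 1)})) =
        (fun z : {x' : Site P' i // φ i x' = runSite x (Fin.cast hd μ') t} =>
          (⟨z.1.shift μ', by rw [hs, z.2, ← runSite_succ]⟩ : {x' : Site P' i // φ i x' = runSite x (Fin.cast hd μ') (t + 1)})) ∘
        (fun x' : {x' : Site P' i // φ i x' = x} =>
          (⟨runSite x'.1 μ' t, by rw [map_runSite hd φ hs, x'.2]⟩ : {x' : Site P' i // φ i x' = runSite x (Fin.cast hd μ') t})) := by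
      funext x'; exact Subtype.ext (runSite_succ x'.1 μ' t)
    rw [hcomp]
    exact hstep.comp ih

/-- the fibre of the bond `⟨x, μ⟩` under `φB` is the fibre of `x` (direction forced): bond fibre sums are site fibre sums. [folklore] -/
theorem sum_bondFibre_eq (i : ℕ) (g : PBond P' i → ℝ) (x : Site P i) (μ' : Fin P'.d) :
    (∑ b' : {b' : PBond P' i // (⟨φ i b'.src, Fin.cast hd b'.dir⟩ : PBond P i) = ⟨x, Fin.cast hd μ'⟩}, g b'.1) =
      ∑ x' : {x' : Site P' i // φ i x' = x}, g ⟨x'.1, μ'⟩ := by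
  refine Fintype.sum_bijective (fun b' : {b' : PBond P' i // (⟨φ i b'.src, Fin.cast hd b'.dir⟩ : PBond P i) = ⟨x, Fin.cast hd μ'⟩} =>
      (⟨b'.1.src, (by simpa only [PBond.mk.injEq] using b'.2 : φ i b'.1.src = x ∧ Fin.cast hd b'.1.dir = Fin.cast hd μ').1⟩ :
        {x' : Site P' i // φ i x' = x})) ?_ (fun b' => g b'.1) (fun x' => g ⟨x'.1, μ'⟩) fun b' => ?_
  · refine Function.bijective_iff_has_inverse.mpr ⟨fun x' => ⟨⟨x'.1, μ'⟩, by rw [x'.2]⟩, fun b' => ?_, fun x' => rfl⟩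
    obtain ⟨⟨s, d⟩, h⟩ := b'
    have h' : φ i s = x ∧ Fin.cast hd d = Fin.cast hd μ' := by simpa only [PBond.mk.injEq] using h
    have hdμ : d = μ' := Fin.ext (by simpa using congrArg Fin.val h'.2)
    subst hdμ; rfl
  · obtain ⟨⟨s, d⟩, h⟩ := b'
    have h' : φ i s = x ∧ Fin.cast hd d = Fin.cast hd μ' := by simpa only [PBond.mk.injEq] using h
    have hdμ : d = μ' := Fin.ext (by simpa using congrArg Fin.val h'.2)
    subst hdμ; rfl

include hL hs hbo in
/-- **`Q(φB_{i*} g)(c) = Σ_{c′ : φB c′ = c} (Q g)(c′)`**, read at `c = ⟨y, μ⟩`. [cite: Balaban1984PropagatorsI, (1.11) p.19] -/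
theorem bondAvg_push (i : ℕ) (hi : i + 1 ≤ P.m + P.K) (hi' : i + 1 ≤ P'.m + P'.K) (g : PBond P' i → ℝ) (y : Site P (i + 1)) (μ' : Fin P'.d) :
    bondAvg (fun b : PBond P i => ∑ b' : {b' : PBond P' i // (⟨φ i b'.src, Fin.cast hd b'.dir⟩ : PBond P i) = b}, g b'.1) ⟨y, Fin.cast hd μ'⟩ =
      ∑ y' : {y' : Site P' (i + 1) // φ (i + 1) y' = y}, bondAvg g ⟨y'.1, μ'⟩ := by
  -- the bond fibre sums are site fibre sums (direction forced), and runs move fibres to fibres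
  have hbond : ∀ x : Site P i, _ := fun x => sum_bondFibre_eq hd φ i g x μ'
  have hrun : ∀ (x : Site P i) (t : ℕ), (∑ x' : {x' : Site P' i // φ i x' = runSite x (Fin.cast hd μ') t}, g ⟨x'.1, μ'⟩) =
      ∑ x' : {x' : Site P' i // φ i x' = x}, g ⟨runSite x'.1 μ' t, μ'⟩ := fun x t =>
    (Fintype.sum_bijective _ (run_fibre_bijective hd φ hs i x μ' t) (fun x' => g ⟨runSite x'.1 μ' t, μ'⟩) (fun x' => g ⟨x'.1, μ'⟩)
      fun x' => rfl).symm
  have e : ((P'.L : ℝ) ^ (P'.d + 1))⁻¹ = ((P.L : ℝ) ^ (P.d + 1))⁻¹ := by rw [hd, hL]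
  -- unfold both sides to triple sums of `G t x' := g ⟨runSite x' μ' t, μ'⟩`
  have lhs : bondAvg (fun b : PBond P i => ∑ b' : {b' : PBond P' i // (⟨φ i b'.src, Fin.cast hd b'.dir⟩ : PBond P i) = b}, g b'.1)
      ⟨y, Fin.cast hd μ'⟩ = ((P.L : ℝ) ^ (P.d + 1))⁻¹ • ∑ r : Fin P.d → Fin P.L, ∑ t ∈ Finset.range P.L,
        ∑ x' : {x' : Site P' i // φ i x' = Site.blockSite y r}, g ⟨runSite x'.1 μ' t, μ'⟩ := by
    simp only [bondAvg, segSum]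
    congr 1
    exact Finset.sum_congr rfl fun r _ => Finset.sum_congr rfl fun t _ => (hbond _).trans (hrun _ _)
  have rhs : ∀ y' : {y' : Site P' (i + 1) // φ (i + 1) y' = y}, bondAvg g ⟨y'.1, μ'⟩ =
      ((P.L : ℝ) ^ (P.d + 1))⁻¹ • ∑ t ∈ Finset.range P.L, ∑ r' : Fin P'.d → Fin P'.L, g ⟨runSite (Site.blockSite y'.1 r') μ' t, μ'⟩ := by
    intro y'
    simp only [bondAvg, segSum, runBond, hL, hd]
    rw [Finset.sum_comm]
  rw [lhs, Fintype.sum_congr _ _ rhs, ← Finset.smul_sum]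
  congr 1
  calc ∑ r : Fin P.d → Fin P.L, ∑ t ∈ Finset.range P.L, ∑ x' : {x' : Site P' i // φ i x' = Site.blockSite y r}, g ⟨runSite x'.1 μ' t, μ'⟩
      = ∑ t ∈ Finset.range P.L, ∑ r : Fin P.d → Fin P.L, ∑ x' : {x' : Site P' i // φ i x' = Site.blockSite y r}, g ⟨runSite x'.1 μ' t, μ'⟩ :=
        Finset.sum_comm
    _ = ∑ t ∈ Finset.range P.L, ∑ y' : {y' : Site P' (i + 1) // φ (i + 1) y' = y}, ∑ r' : Fin P'.d → Fin P'.L,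
          g ⟨runSite (Site.blockSite y'.1 r') μ' t, μ'⟩ :=
        Finset.sum_congr rfl fun t _ => sum_offsets_fibre_blockSite φ hbo i hi hi' y (fun x' => g ⟨runSite x' μ' t, μ'⟩)
    _ = ∑ y' : {y' : Site P' (i + 1) // φ (i + 1) y' = y}, ∑ t ∈ Finset.range P.L, ∑ r' : Fin P'.d → Fin P'.L,
          g ⟨runSite (Site.blockSite y'.1 r') μ' t, μ'⟩ := Finset.sum_comm

include hL hs hbo in
/-- **`Q_k(φB_{0*} g)(⟨y, μ⟩) = Σ_{y′ : φ_k y′ = y} (Q_k g)(⟨y′, μ⟩)`**. [cite: Balaban1984PropagatorsI, (1.18) p.20] -/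
theorem bondAvgIter_push (g : PBond P' 0 → ℝ) :
    ∀ (k : ℕ), k ≤ P.m + P.K → k ≤ P'.m + P'.K → ∀ (y : Site P k) (μ' : Fin P'.d),
      bondAvgIter k (fun b : PBond P 0 => ∑ b' : {b' : PBond P' 0 // (⟨φ 0 b'.src, Fin.cast hd b'.dir⟩ : PBond P 0) = b}, g b'.1)
          ⟨y, Fin.cast hd μ'⟩ =
        ∑ y' : {y' : Site P' k // φ k y' = y}, bondAvgIter k g ⟨y'.1, μ'⟩
  | 0, _, _, y, μ' => sum_bondFibre_eq hd φ 0 g y μ'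
  | k + 1, hk, hk', y, μ' => by
    change bondAvg (bondAvgIter k (fun b : PBond P 0 =>
      ∑ b' : {b' : PBond P' 0 // (⟨φ 0 b'.src, Fin.cast hd b'.dir⟩ : PBond P 0) = b}, g b'.1)) ⟨y, Fin.cast hd μ'⟩ = _
    -- the level-`k` field is the pushforward of `Q_k g` (induction hypothesis at every level-`k` bond; every direction is a cast)
    have ih : bondAvgIter k (fun b : PBond P 0 => ∑ b' : {b' : PBond P' 0 // (⟨φ 0 b'.src, Fin.cast hd b'.dir⟩ : PBond P 0) = b}, g b'.1) =
        fun b : PBond P k => ∑ b' : {b' : PBond P' k // (⟨φ k b'.src, Fin.cast hd b'.dir⟩ : PBond P k) = b}, bondAvgIter k g b'.1 := by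
      funext b
      obtain ⟨z, μ⟩ := b
      have hμ : μ = Fin.cast hd (Fin.cast hd.symm μ) := Fin.ext rfl
      rw [hμ, bondAvgIter_push g k (Nat.le_of_succ_le hk) (Nat.le_of_succ_le hk') z (Fin.cast hd.symm μ),
        sum_bondFibre_eq hd φ k (bondAvgIter k g) z (Fin.cast hd.symm μ)]
    rw [ih, bondAvg_push hd hL φ hs hbo k hk hk']
    rfl

end Summit.QuantumFields.YangMills.Theorems.CoverAverages

end
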